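import Summits.AtomisticToContinuum.Crystallization.Theorems.ChessboardParticlePlanesPeriodicWindowsOfGoodWindows

/-!
# Crux `StackingFaultSparsity` (stmt-AtomisticToContinuum-14296), line `Sketch` (reshape 11):
# stub S3 `stub_barlowOfCommonNormal`

A nonempty point set `X ⊆ ℝ³` all of whose points carry an exact local frame (the `ε = 0`
`GOOD(2, 1)` frame: lengths `a, b ∈ [19/20, 1]`, levels `c` with `c 0 = 0` and gaps `≥ 19/25`,
exact heights on the open `2`-ball, global `19/20`-separation, the exact closed unit shell
`H ∪ U ∪ D`) with COMMON lengths `(a, b)` and COMMON normal `±n` is an isometric image of the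
Barlow stacking `barlowStacking a √(b² − a²/3) s` of a Hägg word `s`.

Proof (plumbing of the landed exact rigidity E0b1–3 of the `PeriodicWindows` line).  Rotate
`n ↦ e₃` (`gl_exists_rotation_height`) and recentre at a point `p₀ ∈ X`:
`X' = {B (x − p₀) | x ∈ X} ∋ 0`, heights `(B (x − p₀)) 2 − (B (y − p₀)) 2 = ⟪x − y, n⟫`.
The frame at each point (normal `n` or `−n`; for `−n` the up- and down-triples swap) gives the
hypotheses of `stub_hexClosure` / `stub_levelLattice` (same-height sharpness from the closed-shell
exactness, six level-mates, separation), so every level of `X'` is a full triangular lattice;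
rounding in such a lattice brings any second point within squared horizontal distance `3/4` of the
first, hence (if the height difference is `< 19/25`) within distance `2`, where the exact-heights
clause and the level gaps give the GLOBAL level-gap dichotomy; then `stub_levelRegistry` and
`stub_barlowOfLevels` identify `X' = A '' barlowStacking a h s`, and `X` is its image under the
isometry `z ↦ p₀ + B⁻¹ (A z)`.  All `[folklore]`.
-/

noncomputable section

namespace Summit.AtomisticToContinuum.Crystallization.Theorems.SquareWellLayerCake.StackingFaultSparsity.LocalFrames.CommonNormal

open Literature.MathematicalPhysics.StatisticalMechanics Metric
open Summit.AtomisticToContinuum.Crystallization.Theorems.PeriodicWindowsSketch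

/-! ## The local frame at one point, read with a general normal `m` -/

/-- What the exact local frame at `p` (normal `m`, levels `c`) yields: the bounds on `a, b`,
`‖m‖ = 1`, global separation; same-height sharpness at `p` (closed-shell exactness, `c 1 ≥ 19/25`,
`c (−1) ≤ −19/25`); the six level-mates; the up- and down-triples at heights `c 1 > 0`,
`c (−1) < 0`; and the local level-gap dichotomy on the open `2`-ball (`gl_level_gap_abs`).
[folklore] -/
theorem cn_frame_facts {X : Set (EuclideanSpace ℝ (Fin 3))} {a b : ℝ} {m p : EuclideanSpace ℝ (Fin 3)}
    (h : ∃ c : ℤ → ℝ, (19 / 20 ≤ a ∧ a ≤ 1 ∧ 19 / 20 ≤ b ∧ b ≤ 1 ∧ ‖m‖ = 1 ∧ c 0 = 0 ∧ (∀ k : ℤ, c k + 19 / 25 ≤ c (k + 1)) ∧ (∀ q ∈ X, ∀ r ∈ X, q ≠ r → 19 / 20 ≤ dist q r) ∧ (∀ q ∈ X, dist q p < 2 → ∃ k : ℤ, inner ℝ (q - p) m = c k) ∧ (∃ H U D : Finset (EuclideanSpace ℝ (Fin 3)), H.card = 6 ∧ U.card = 3 ∧ D.card = 3 ∧ (∀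 q ∈ H, q ∈ X ∧ inner ℝ (q - p) m = 0 ∧ dist p q = a) ∧ (∀ q ∈ U, q ∈ X ∧ inner ℝ (q - p) m = c 1 ∧ dist p q = b) ∧ (∀ q ∈ D, q ∈ X ∧ inner ℝ (q - p) m = c (-1) ∧ dist p q = b) ∧ (∀ q ∈ X, q ≠ p → dist q p ≤ 1 → q ∈ H ∨ q ∈ U ∨ q ∈ D)) ∧ (∀ q ∈ X, q ≠ p → dist q p ≤ 1 → (∃ H' : Finset (EuclideanSpace ℝ (Fin 3)), H'.card = 6 ∧ ∀ r ∈ H', r ∈ X ∧ r ≠ q ∧ inner ℝ (r - p) m = inner ℝ (q - p) m ∧ dist q r = a) ∧ (∃ U' : Finset (EuclideanSpace ℝ (Fin 3)), U'.card = 3 ∧ ∀ r ∈ U', r ∈ X ∧ (∃ k : ℤ, inner ℝ (q - p) m = c k ∧ inner ℝ (r - p) m = c (k + 1)) ∧ dist q r = b) ∧ (∃ D' : Finset (EuclideanSpace ℝ (Fin 3)), D'.card = 3 ∧ ∀ r ∈ D', r ∈ X ∧ (∃ k : ℤ, inner ℝ (q - p) m = c k ∧ inner ℝ (r - p) m = c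 (k - 1)) ∧ dist q r = b) ∧ (∀ r ∈ X, r ≠ q → dist q r < 1 → (inner ℝ (r - p) m = inner ℝ (q - p) m → dist q r = a) ∧ (inner ℝ (r - p) m ≠ inner ℝ (q - p) m → dist q r = b))))) :
    (19 / 20 ≤ a ∧ a ≤ 1 ∧ 19 / 20 ≤ b ∧ b ≤ 1 ∧ ‖m‖ = 1 ∧
      ∀ q ∈ X, ∀ r ∈ X, q ≠ r → 19 / 20 ≤ dist q r) ∧
    (∀ q ∈ X, q ≠ p → dist q p < 1 → inner ℝ (q - p) m = 0 → dist p q = a) ∧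
    (∃ F : Finset (EuclideanSpace ℝ (Fin 3)), F.card = 6 ∧
      ∀ q ∈ F, q ∈ X ∧ inner ℝ (q - p) m = 0 ∧ dist p q = a) ∧
    (∃ g : ℝ, 0 < g ∧ ∃ F : Finset (EuclideanSpace ℝ (Fin 3)), F.card = 3 ∧
      ∀ q ∈ F, q ∈ X ∧ inner ℝ (q - p) m = g ∧ dist p q = b) ∧
    (∃ g : ℝ, 0 < g ∧ ∃ F : Finset (EuclideanSpace ℝ (Fin 3)), F.card = 3 ∧
      ∀ q ∈ F, q ∈ X ∧ inner ℝ (q - p) m = -g ∧ dist p q = b) ∧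
    (∀ q ∈ X, dist q p < 2 → inner ℝ (q - p) m = 0 ∨ 19 / 25 ≤ |inner ℝ (q - p) m|) := by
  obtain ⟨c, ha1, ha2, hb1, hb2, hm, hc0, hc, hsep, hlev, ⟨H, U, D, hH, hU, hD, hHm, hUm, hDm, hex⟩,
    -⟩ := h
  have hc1 : 19 / 25 ≤ c 1 := by
    have := hc 0
    rwa [hc0, zero_add, zero_add] at this
  have hcm1 : c (-1) ≤ -(19 / 25) := by
    have := hc (-1)
    rw [show (-1 : ℤ) + 1 = 0 by norm_num, hc0] at this
    linarith
  refine ⟨⟨ha1, ha2, hb1, hb2, hm, hsep⟩, ?_, ⟨H, hH, hHm⟩, ⟨c 1, by linarith, U, hU, hUm⟩,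
    ⟨-c (-1), by linarith, D, hD, fun q hq => ?_⟩, ?_⟩
  · intro q hq hqp hd h0
    rcases hex q hq hqp hd.le with hqH | hqU | hqD
    · exact (hHm q hqH).2.2
    · exfalso
      have := (hUm q hqU).2.1
      rw [h0] at this
      linarith
    · exfalso
      have := (hDm q hqD).2.1
      rw [h0] at this
      linarith
  · obtain ⟨h1, h2, h3⟩ := hDm q hq
    exact ⟨h1, by rw [h2, neg_neg], h3⟩
  · intro q hq hd
    obtain ⟨k, hk⟩ := hlev q hq hd
    by_cases hk0 : k = 0
    · left
      rw [hk, hk0, hc0]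
    · right
      rw [hk]
      have := gl_level_gap_abs c hc hk0
      rwa [hc0, sub_zero] at this

/-- Reading a frame with normal `−n` as a frame with normal `n`: heights change sign, the up- and
down-triples swap. [folklore] -/
theorem cn_facts_of_neg {X : Set (EuclideanSpace ℝ (Fin 3))} {a b : ℝ} {n p : EuclideanSpace ℝ (Fin 3)}
    (h1 : ∀ q ∈ X, q ≠ p → dist q p < 1 → inner ℝ (q - p) (-n) = 0 → dist p q = a)
    (h2 : ∃ F : Finset (EuclideanSpace ℝ (Fin 3)), F.card = 6 ∧
      ∀ q ∈ F, q ∈ X ∧ inner ℝ (q - p) (-n) = 0 ∧ dist p q = a)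
    (h3 : ∃ g : ℝ, 0 < g ∧ ∃ F : Finset (EuclideanSpace ℝ (Fin 3)), F.card = 3 ∧
      ∀ q ∈ F, q ∈ X ∧ inner ℝ (q - p) (-n) = g ∧ dist p q = b)
    (h4 : ∃ g : ℝ, 0 < g ∧ ∃ F : Finset (EuclideanSpace ℝ (Fin 3)), F.card = 3 ∧
      ∀ q ∈ F, q ∈ X ∧ inner ℝ (q - p) (-n) = -g ∧ dist p q = b)
    (h5 : ∀ q ∈ X, dist q p < 2 → inner ℝ (q - p) (-n) = 0 ∨ 19 / 25 ≤ |inner ℝ (q - p) (-n)|) :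
    (∀ q ∈ X, q ≠ p → dist q p < 1 → inner ℝ (q - p) n = 0 → dist p q = a) ∧
    (∃ F : Finset (EuclideanSpace ℝ (Fin 3)), F.card = 6 ∧
      ∀ q ∈ F, q ∈ X ∧ inner ℝ (q - p) n = 0 ∧ dist p q = a) ∧
    (∃ g : ℝ, 0 < g ∧ ∃ F : Finset (EuclideanSpace ℝ (Fin 3)), F.card = 3 ∧
      ∀ q ∈ F, q ∈ X ∧ inner ℝ (q - p) n = g ∧ dist p q = b) ∧
    (∃ g : ℝ, 0 < g ∧ ∃ F : Finset (EuclideanSpace ℝ (Fin 3)), F.card = 3 ∧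
      ∀ q ∈ F, q ∈ X ∧ inner ℝ (q - p) n = -g ∧ dist p q = b) ∧
    (∀ q ∈ X, dist q p < 2 → inner ℝ (q - p) n = 0 ∨ 19 / 25 ≤ |inner ℝ (q - p) n|) := by
  refine ⟨fun q hq hqp hd h0 => h1 q hq hqp hd (by rw [inner_neg_right, h0, neg_zero]), ?_, ?_, ?_,
    fun q hq hd => ?_⟩
  · obtain ⟨F, hF, hFm⟩ := h2
    refine ⟨F, hF, fun q hq => ?_⟩
    obtain ⟨x1, x2, x3⟩ := hFm q hq
    rw [inner_neg_right, neg_eq_zero] at x2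
    exact ⟨x1, x2, x3⟩
  · obtain ⟨g, hg, F, hF, hFm⟩ := h4
    refine ⟨g, hg, F, hF, fun q hq => ?_⟩
    obtain ⟨x1, x2, x3⟩ := hFm q hq
    rw [inner_neg_right, neg_inj] at x2
    exact ⟨x1, x2, x3⟩
  · obtain ⟨g, hg, F, hF, hFm⟩ := h3
    refine ⟨g, hg, F, hF, fun q hq => ?_⟩
    obtain ⟨x1, x2, x3⟩ := hFm q hq
    rw [inner_neg_right, neg_eq_iff_eq_neg] at x2
    exact ⟨x1, x2, x3⟩
  · have := h5 q hq hd
    rwa [inner_neg_right, neg_eq_zero, abs_neg] at this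

/-! ## Rotating and recentring: `x ↦ B (x − p₀)` -/

/-- Heights in the rotated recentred picture are inner products with `n`. -/
theorem cn_height_sub (B : EuclideanSpace ℝ (Fin 3) ≃ₗᵢ[ℝ] EuclideanSpace ℝ (Fin 3))
    {n : EuclideanSpace ℝ (Fin 3)} (hB : ∀ z, (B z) 2 = inner ℝ z n) (x y p₀ : EuclideanSpace ℝ (Fin 3)) :
    (B (x - p₀)) 2 - (B (y - p₀)) 2 = inner ℝ (x - y) n := by
  rw [hB, hB, ← inner_sub_left, sub_sub_sub_cancel_right]

/-- `x ↦ B (x − p₀)` is injective. -/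
theorem cn_map_inj (B : EuclideanSpace ℝ (Fin 3) ≃ₗᵢ[ℝ] EuclideanSpace ℝ (Fin 3))
    {x y p₀ : EuclideanSpace ℝ (Fin 3)} (h : B (x - p₀) = B (y - p₀)) : x = y :=
  sub_left_inj.1 (B.injective h)

/-- Separation is preserved by `x ↦ B (x − p₀)`. -/
theorem cn_img_sep {X : Set (EuclideanSpace ℝ (Fin 3))}
    (B : EuclideanSpace ℝ (Fin 3) ≃ₗᵢ[ℝ] EuclideanSpace ℝ (Fin 3)) (p₀ : EuclideanSpace ℝ (Fin 3))
    (hsep : ∀ q ∈ X, ∀ r ∈ X, q ≠ r → 19 / 20 ≤ dist q r) :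
    ∀ p ∈ (fun x => B (x - p₀)) '' X, ∀ q ∈ (fun x => B (x - p₀)) '' X, p ≠ q →
      19 / 20 ≤ dist p q := by
  rintro _ ⟨x, hx, rfl⟩ _ ⟨y, hy, rfl⟩ hne
  rw [gl_dist_map_sub_sub]
  exact hsep x hx y hy fun h => hne (by rw [h])

/-- Same-height sharpness in the rotated recentred picture. -/
theorem cn_img_sharp {X : Set (EuclideanSpace ℝ (Fin 3))} {a : ℝ} {n : EuclideanSpace ℝ (Fin 3)}
    (B : EuclideanSpace ℝ (Fin 3) ≃ₗᵢ[ℝ] EuclideanSpace ℝ (Fin 3)) (hB : ∀ z, (B z) 2 = inner ℝ z n)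
    (p₀ : EuclideanSpace ℝ (Fin 3))
    (h1 : ∀ p ∈ X, ∀ q ∈ X, q ≠ p → dist q p < 1 → inner ℝ (q - p) n = 0 → dist p q = a) :
    ∀ p ∈ (fun x => B (x - p₀)) '' X, ∀ q ∈ (fun x => B (x - p₀)) '' X, p ≠ q → dist p q < 1 →
      q 2 = p 2 → dist p q = a := by
  rintro _ ⟨x, hx, rfl⟩ _ ⟨y, hy, rfl⟩ hne hd h2
  rw [gl_dist_map_sub_sub] at hd ⊢
  refine h1 x hx y hy (fun h => hne (by rw [h])) (by rw [dist_comm]; exact hd) ?_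
  rw [← cn_height_sub B hB y x p₀, h2, sub_self]

/-- A finite family of points of `X` at inner-product height `g` above `x` and distance `d` from
`x` becomes, under `x ↦ B (x − p₀)`, a family of the same size at coordinate height `+ g`. -/
theorem cn_img_finset {X : Set (EuclideanSpace ℝ (Fin 3))} {d g : ℝ} {n : EuclideanSpace ℝ (Fin 3)}
    (B : EuclideanSpace ℝ (Fin 3) ≃ₗᵢ[ℝ] EuclideanSpace ℝ (Fin 3)) (hB : ∀ z, (B z) 2 = inner ℝ z n)
    (p₀ x : EuclideanSpace ℝ (Fin 3)) {N : ℕ}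
    (h : ∃ F : Finset (EuclideanSpace ℝ (Fin 3)), F.card = N ∧
      ∀ q ∈ F, q ∈ X ∧ inner ℝ (q - x) n = g ∧ dist x q = d) :
    ∃ F : Finset (EuclideanSpace ℝ (Fin 3)), F.card = N ∧ ∀ q ∈ F, q ∈ (fun x => B (x - p₀)) '' X ∧
      q 2 = (B (x - p₀)) 2 + g ∧ dist (B (x - p₀)) q = d := by
  obtain ⟨F, hF, hFm⟩ := h
  refine ⟨F.image (fun x => B (x - p₀)), ?_, ?_⟩
  · rw [Finset.card_image_of_injective _ (fun y y' h => cn_map_inj B h), hF]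
  · intro q hq
    obtain ⟨y, hy, rfl⟩ := Finset.mem_image.1 hq
    obtain ⟨hyX, hyn, hyd⟩ := hFm y hy
    refine ⟨⟨y, hyX, rfl⟩, ?_, by rw [gl_dist_map_sub_sub]; exact hyd⟩
    have := cn_height_sub B hB y x p₀
    rw [hyn] at this
    linarith

/-! ## Rounding in a triangular lattice and the global level-gap dichotomy -/

/-- Rounding in the triangular lattice `q + ℤu + ℤv` (spacing `a ≤ 1`): some lattice point is
within squared distance `3/4 + (p 2 − q 2)²` of `p`. [folklore] -/
theorem cn_round {a : ℝ} (ha : 0 < a) (ha2 : a ≤ 1) {u v : EuclideanSpace ℝ (Fin 3)} (hu2 : u 2 = 0)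
    (hv2 : v 2 = 0) (hu : ‖u‖ = a) (hv : ‖v‖ = a) (huv : inner ℝ u v = a ^ 2 / 2)
    (p q : EuclideanSpace ℝ (Fin 3)) :
    ∃ i j : ℤ, dist p (q + (i : ℝ) • u + (j : ℝ) • v) ^ 2 ≤ 3 / 4 + (p 2 - q 2) ^ 2 := by
  obtain ⟨α, β, hαβ⟩ := levelLattice_decomp ha hu2 hv2 hu hv huv
    (d := p - q - (p 2 - q 2) • EuclideanSpace.single (2 : Fin 3) (1 : ℝ)) (by simp)
  refine ⟨round α, round β, ?_⟩
  have hdiff : p - (q + ((round α : ℤ) : ℝ) • u + ((round β : ℤ) : ℝ) • v) =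
      ((α - round α) • u + (β - round β) • v) +
        (p 2 - q 2) • EuclideanSpace.single (2 : Fin 3) (1 : ℝ) := by
    have e1 : p - q = α • u + β • v + (p 2 - q 2) • EuclideanSpace.single (2 : Fin 3) (1 : ℝ) := by
      rw [← hαβ, sub_add_cancel]
    calc p - (q + ((round α : ℤ) : ℝ) • u + ((round β : ℤ) : ℝ) • v)
        = (p - q) - ((round α : ℤ) : ℝ) • u - ((round β : ℤ) : ℝ) • v := by abel
      _ = _ := by rw [e1]; module
  set w : EuclideanSpace ℝ (Fin 3) := (α - round α) • u + (β - round β) • v with hw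
  have hw2 : w 2 = 0 := by simp [hw, hu2, hv2]
  have hnorm : ‖w + (p 2 - q 2) • EuclideanSpace.single (2 : Fin 3) (1 : ℝ)‖ ^ 2 =
      ‖w‖ ^ 2 + (p 2 - q 2) ^ 2 := by
    rw [norm_add_sq_real, real_inner_smul_right, EuclideanSpace.inner_single_right, hw2, norm_smul,
      PiLp.norm_single, Real.norm_eq_abs, mul_pow, sq_abs]
    simp
  have hwle : ‖w‖ ^ 2 ≤ 3 / 4 := by
    rw [hw, levelLattice_norm_sq_comb hu hv huv]
    obtain ⟨hα1, hα2⟩ := abs_le.1 (abs_sub_round α)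
    obtain ⟨hβ1, hβ2⟩ := abs_le.1 (abs_sub_round β)
    have hsum : (α - round α) ^ 2 + (α - round α) * (β - round β) + (β - round β) ^ 2 ≤ 3 / 4 := by
      nlinarith [mul_nonneg (sub_nonneg.2 hα2) (neg_le_iff_add_nonneg'.1 hα1),
        mul_nonneg (sub_nonneg.2 hβ2) (neg_le_iff_add_nonneg'.1 hβ1),
        mul_nonneg (sub_nonneg.2 hα2) (neg_le_iff_add_nonneg'.1 hβ1),
        mul_nonneg (sub_nonneg.2 hβ2) (neg_le_iff_add_nonneg'.1 hα1)]
    have hnn : 0 ≤ (α - round α) ^ 2 + (α - round α) * (β - round β) + (β - round β) ^ 2 := by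
      nlinarith [sq_nonneg (α - round α + (β - round β)), sq_nonneg (α - round α),
        sq_nonneg (β - round β)]
    have hsq : a ^ 2 ≤ 1 := by nlinarith
    nlinarith
  rw [dist_eq_norm, hdiff, hnorm]
  linarith

/-- **Global level-gap dichotomy.**  If every level of `X' = {B (x − p₀)}` is a full triangular
lattice and every point of `X` sees, on its open `2`-ball, only heights `0` or `≥ 19/25` in
absolute value, then ANY two heights of `X'` are equal or `≥ 19/25` apart (round in the level of
the second point to get within distance `2` of the first). [folklore] -/
theorem cn_img_gap {X : Set (EuclideanSpace ℝ (Fin 3))} {a : ℝ} {n : EuclideanSpace ℝ (Fin 3)}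
    (ha1 : 19 / 20 ≤ a) (ha2 : a ≤ 1) (B : EuclideanSpace ℝ (Fin 3) ≃ₗᵢ[ℝ] EuclideanSpace ℝ (Fin 3))
    (hB : ∀ z, (B z) 2 = inner ℝ z n) (p₀ : EuclideanSpace ℝ (Fin 3))
    (h5 : ∀ p ∈ X, ∀ q ∈ X, dist q p < 2 →
      inner ℝ (q - p) n = 0 ∨ 19 / 25 ≤ |inner ℝ (q - p) n|)
    (hlat : ∀ p ∈ (fun x => B (x - p₀)) '' X, ∃ u v : EuclideanSpace ℝ (Fin 3), u 2 = 0 ∧ v 2 = 0 ∧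
      ‖u‖ = a ∧ ‖v‖ = a ∧ inner ℝ u v = a ^ 2 / 2 ∧
      {q ∈ (fun x => B (x - p₀)) '' X | q 2 = p 2} =
        {q | ∃ i j : ℤ, q = p + (i : ℝ) • u + (j : ℝ) • v}) :
    ∀ p ∈ (fun x => B (x - p₀)) '' X, ∀ q ∈ (fun x => B (x - p₀)) '' X,
      q 2 = p 2 ∨ 19 / 25 ≤ |q 2 - p 2| := by
  intro p hp q hq
  by_cases hbig : 19 / 25 ≤ |q 2 - p 2|
  · exact Or.inr hbig
  obtain ⟨u, v, hu2, hv2, hu, hv, huv, hlev⟩ := hlat q hq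
  obtain ⟨i, j, hij⟩ := cn_round (by linarith) ha2 hu2 hv2 hu hv huv p q
  have hq' : q + (i : ℝ) • u + (j : ℝ) • v ∈ {r ∈ (fun x => B (x - p₀)) '' X | r 2 = q 2} := by
    rw [hlev]
    exact ⟨i, j, rfl⟩
  obtain ⟨⟨y, hy, hyq⟩, hq'2⟩ := hq'
  obtain ⟨x, hx, rfl⟩ := hp
  dsimp only at hyq hij hbig ⊢
  have hlt : |q 2 - (B (x - p₀)) 2| < 19 / 25 := not_le.1 hbig
  have hd : dist (B (x - p₀)) (q + (i : ℝ) • u + (j : ℝ) • v) < 2 := by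
    have hsq : ((B (x - p₀)) 2 - q 2) ^ 2 < 1 := by
      rw [← sq_abs, abs_sub_comm]
      nlinarith [abs_nonneg (q 2 - (B (x - p₀)) 2)]
    nlinarith [dist_nonneg (x := B (x - p₀)) (y := q + (i : ℝ) • u + (j : ℝ) • v)]
  have h := h5 x hx y hy (by rw [← gl_dist_map_sub_sub B y x p₀, hyq, dist_comm]; exact hd)
  have hh : inner ℝ (y - x) n = q 2 - (B (x - p₀)) 2 := by
    rw [← cn_height_sub B hB y x p₀, hyq]
    exact congrArg (· - (B (x - p₀)) 2) hq'2
  rw [hh] at h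
  rcases h with h | h
  · exact Or.inl (sub_eq_zero.1 h)
  · exact Or.inr h

/-! ## The stub -/

/-- **Stub S3 — locally framed sets with a common frame are Barlow.**  A nonempty `X ⊆ ℝ³` all of
whose points carry an exact local frame with common lengths `(a, b)` and common normal `±n` is an
isometric image of `barlowStacking a √(b² − a²/3) s` for a Hägg word `s` (rotate `n ↦ e₃`,
recentre; `stub_hexClosure`, `stub_levelLattice`, the global level-gap dichotomy `cn_img_gap`,
`stub_levelRegistry`, `stub_barlowOfLevels`; back through `z ↦ p₀ + B⁻¹ (A z)`). [folklore] -/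
theorem stub_barlowOfCommonNormal :
    ∀ (X : Set (EuclideanSpace ℝ (Fin 3))) (a b : ℝ) (n : EuclideanSpace ℝ (Fin 3)), X.Nonempty → (∀ p ∈ X, (∃ c : ℤ → ℝ, (19 / 20 ≤ a ∧ a ≤ 1 ∧ 19 / 20 ≤ b ∧ b ≤ 1 ∧ ‖n‖ = 1 ∧ c 0 = 0 ∧ (∀ k : ℤ, c k + 19 / 25 ≤ c (k + 1)) ∧ (∀ q ∈ X, ∀ r ∈ X, q ≠ r → 19 / 20 ≤ dist q r) ∧ (∀ q ∈ X, dist q p < 2 → ∃ k : ℤ, inner ℝ (q - p) n = c k) ∧ (∃ H U D : Finset (EuclideanSpace ℝ (Fin 3)), H.card = 6 ∧ U.card = 3 ∧ D.card = 3 ∧ (∀ q ∈ H, q ∈ X ∧ inner ℝ (q - p) n = 0 ∧ dist p q = a) ∧ (∀ q ∈ U, q ∈ X ∧ inner ℝ (q - p) n = c 1 ∧ dist p q = b) ∧ (∀ q ∈ D, q ∈ X ∧ inner ℝ (q - p) n = c (-1) ∧ dist p q = b) ∧ (∀ q ∈ X, q ≠ p → dist q p ≤ 1 → q ∈ H ∨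 q ∈ U ∨ q ∈ D)) ∧ (∀ q ∈ X, q ≠ p → dist q p ≤ 1 → (∃ H' : Finset (EuclideanSpace ℝ (Fin 3)), H'.card = 6 ∧ ∀ r ∈ H', r ∈ X ∧ r ≠ q ∧ inner ℝ (r - p) n = inner ℝ (q - p) n ∧ dist q r = a) ∧ (∃ U' : Finset (EuclideanSpace ℝ (Fin 3)), U'.card = 3 ∧ ∀ r ∈ U', r ∈ X ∧ (∃ k : ℤ, inner ℝ (q - p) n = c k ∧ inner ℝ (r - p) n = c (k + 1)) ∧ dist q r = b) ∧ (∃ D' : Finset (EuclideanSpace ℝ (Fin 3)), D'.card = 3 ∧ ∀ r ∈ D', r ∈ X ∧ (∃ k : ℤ, inner ℝ (q - p) n = c k ∧ inner ℝ (r - p) n = c (k - 1)) ∧ dist q r = b) ∧ (∀ r ∈ X, r ≠ q → dist q r < 1 → (inner ℝ (r - p) n = inner ℝ (q - p) n → dist q r = a) ∧ (inner ℝ (r - p) n ≠ inner ℝ (q - p) n → dist q r = b))))) ∨ (∃ c : ℤ → ℝ, (19 / 20 ≤ a ∧ a ≤ 1 ∧ 19 / 20 ≤ b ∧ b ≤ 1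 ∧ ‖(-n)‖ = 1 ∧ c 0 = 0 ∧ (∀ k : ℤ, c k + 19 / 25 ≤ c (k + 1)) ∧ (∀ q ∈ X, ∀ r ∈ X, q ≠ r → 19 / 20 ≤ dist q r) ∧ (∀ q ∈ X, dist q p < 2 → ∃ k : ℤ, inner ℝ (q - p) (-n) = c k) ∧ (∃ H U D : Finset (EuclideanSpace ℝ (Fin 3)), H.card = 6 ∧ U.card = 3 ∧ D.card = 3 ∧ (∀ q ∈ H, q ∈ X ∧ inner ℝ (q - p) (-n) = 0 ∧ dist p q = a) ∧ (∀ q ∈ U, q ∈ X ∧ inner ℝ (q - p) (-n) = c 1 ∧ dist p q = b) ∧ (∀ q ∈ D, q ∈ X ∧ inner ℝ (q - p) (-n) = c (-1) ∧ dist p q = b) ∧ (∀ q ∈ X, q ≠ p → dist q p ≤ 1 → q ∈ H ∨ q ∈ U ∨ q ∈ D)) ∧ (∀ q ∈ X, q ≠ p → dist q p ≤ 1 → (∃ H' : Finset (EuclideanSpace ℝ (Fin 3)), H'.card = 6 ∧ ∀ r ∈ H', r ∈ X ∧ r ≠ q ∧ inner ℝ (r - p) (-n) = inner ℝ (q - p)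 (-n) ∧ dist q r = a) ∧ (∃ U' : Finset (EuclideanSpace ℝ (Fin 3)), U'.card = 3 ∧ ∀ r ∈ U', r ∈ X ∧ (∃ k : ℤ, inner ℝ (q - p) (-n) = c k ∧ inner ℝ (r - p) (-n) = c (k + 1)) ∧ dist q r = b) ∧ (∃ D' : Finset (EuclideanSpace ℝ (Fin 3)), D'.card = 3 ∧ ∀ r ∈ D', r ∈ X ∧ (∃ k : ℤ, inner ℝ (q - p) (-n) = c k ∧ inner ℝ (r - p) (-n) = c (k - 1)) ∧ dist q r = b) ∧ (∀ r ∈ X, r ≠ q → dist q r < 1 → (inner ℝ (r - p) (-n) = inner ℝ (q - p) (-n) → dist q r = a) ∧ (inner ℝ (r - p) (-n) ≠ inner ℝ (q - p) (-n) → dist q r = b)))))) → ∃ s : ℤ → ℤ, Literature.MathematicalPhysics.StatisticalMechanics.IsHaggSeq s ∧ ∃ g : EuclideanSpace ℝ (Fin 3) ≃ᵢ EuclideanSpace ℝ (Fin 3), X = g '' Literature.MathematicalPhysics.StatisticalMechanics.barlowStacking a (√(b ^ 2 - a ^ 2 / 3)) s := by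
  intro X a b n hne hfr
  -- the frame at every point, read with normal `n`
  have hP : ∀ p ∈ X, (19 / 20 ≤ a ∧ a ≤ 1 ∧ 19 / 20 ≤ b ∧ b ≤ 1 ∧ ‖n‖ = 1 ∧
        ∀ q ∈ X, ∀ r ∈ X, q ≠ r → 19 / 20 ≤ dist q r) ∧
      (∀ q ∈ X, q ≠ p → dist q p < 1 → inner ℝ (q - p) n = 0 → dist p q = a) ∧
      (∃ F : Finset (EuclideanSpace ℝ (Fin 3)), F.card = 6 ∧
        ∀ q ∈ F, q ∈ X ∧ inner ℝ (q - p) n = 0 ∧ dist p q = a) ∧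
      (∃ g : ℝ, 0 < g ∧ ∃ F : Finset (EuclideanSpace ℝ (Fin 3)), F.card = 3 ∧
        ∀ q ∈ F, q ∈ X ∧ inner ℝ (q - p) n = g ∧ dist p q = b) ∧
      (∃ g : ℝ, 0 < g ∧ ∃ F : Finset (EuclideanSpace ℝ (Fin 3)), F.card = 3 ∧
        ∀ q ∈ F, q ∈ X ∧ inner ℝ (q - p) n = -g ∧ dist p q = b) ∧
      (∀ q ∈ X, dist q p < 2 → inner ℝ (q - p) n = 0 ∨ 19 / 25 ≤ |inner ℝ (q - p) n|) := by
    intro p hp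
    rcases hfr p hp with h | h
    · exact cn_frame_facts h
    · obtain ⟨⟨ha1, ha2, hb1, hb2, hm, hsep⟩, h1, h2, h3, h4, h5⟩ := cn_frame_facts h
      exact ⟨⟨ha1, ha2, hb1, hb2, by rwa [norm_neg] at hm, hsep⟩, cn_facts_of_neg h1 h2 h3 h4 h5⟩
  obtain ⟨p₀, hp₀⟩ := hne
  obtain ⟨⟨ha1, ha2, hb1, hb2, hn, hsep⟩, -⟩ := hP p₀ hp₀
  obtain ⟨B, hB⟩ := gl_exists_rotation_height n hn
  -- the hypotheses of E0b1–3 for `X' = {B (x − p₀) | x ∈ X}`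
  have h0 : (0 : EuclideanSpace ℝ (Fin 3)) ∈ (fun x => B (x - p₀)) '' X := ⟨p₀, hp₀, by simp⟩
  have hsep' := cn_img_sep B p₀ hsep
  have hsharp' := cn_img_sharp B hB p₀ fun p hp => (hP p hp).2.1
  have hsix' : ∀ p ∈ (fun x => B (x - p₀)) '' X,
      ∃ F : Finset (EuclideanSpace ℝ (Fin 3)), F.card = 6 ∧
        ∀ q ∈ F, q ∈ (fun x => B (x - p₀)) '' X ∧ q 2 = p 2 ∧ dist p q = a := by
    rintro _ ⟨x, hx, rfl⟩
    obtain ⟨F, hF, hFm⟩ := cn_img_finset B hB p₀ x (hP x hx).2.2.1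
    exact ⟨F, hF, fun q hq => let ⟨y1, y2, y3⟩ := hFm q hq; ⟨y1, by rw [y2, add_zero], y3⟩⟩
  have hup' : ∀ p ∈ (fun x => B (x - p₀)) '' X, ∃ g : ℝ, 0 < g ∧
      ∃ F : Finset (EuclideanSpace ℝ (Fin 3)), F.card = 3 ∧
        ∀ q ∈ F, q ∈ (fun x => B (x - p₀)) '' X ∧ q 2 = p 2 + g ∧ dist p q = b := by
    rintro _ ⟨x, hx, rfl⟩
    obtain ⟨g, hg, hF⟩ := (hP x hx).2.2.2.1
    exact ⟨g, hg, cn_img_finset B hB p₀ x hF⟩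
  have hdn' : ∀ p ∈ (fun x => B (x - p₀)) '' X, ∃ g : ℝ, 0 < g ∧
      ∃ F : Finset (EuclideanSpace ℝ (Fin 3)), F.card = 3 ∧
        ∀ q ∈ F, q ∈ (fun x => B (x - p₀)) '' X ∧ q 2 = p 2 - g ∧ dist p q = b := by
    rintro _ ⟨x, hx, rfl⟩
    obtain ⟨g, hg, hF⟩ := (hP x hx).2.2.2.2.1
    obtain ⟨F, hF, hFm⟩ := cn_img_finset B hB p₀ x hF
    exact ⟨g, hg, F, hF, fun q hq => let ⟨y1, y2, y3⟩ := hFm q hq; ⟨y1, by rw [y2]; ring, y3⟩⟩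
  have hhex := stub_hexClosure _ a ha1 ha2 hsharp' hsix'
  have hlat := stub_levelLattice _ a ha1 ha2 hsep' hsix' hhex
  have hgap := cn_img_gap ha1 ha2 B hB p₀ (fun p hp => (hP p hp).2.2.2.2.2) hlat
  -- E0b1–3
  obtain ⟨u, v, hu2, hv2, hu, hv, huv, hlev0⟩ := hlat 0 h0
  obtain ⟨hh1, -⟩ := sqrt_gap_bounds ha1 ha2 hb1 hb2
  have ha : 0 < a := by linarith
  have hh : 0 < Real.sqrt (b ^ 2 - a ^ 2 / 3) := by linarith
  have hlev0' : {q ∈ (fun x => B (x - p₀)) '' X | q 2 = 0} =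
      {q | ∃ i j : ℤ, q = (i : ℝ) • u + (j : ℝ) • v} := by
    rw [show (0 : ℝ) = (0 : EuclideanSpace ℝ (Fin 3)) 2 from rfl, hlev0]
    ext q
    simp only [Set.mem_setOf_eq, zero_add]
  obtain ⟨s, A, hs, hXeq⟩ := stub_barlowOfLevels _ a (Real.sqrt (b ^ 2 - a ^ 2 / 3)) ha hh h0 u v
    hu2 hv2 hu hv huv hlev0' fun p hp hlev =>
      stub_levelRegistry _ a b ha1 ha2 hb1 hb2 hsep' hgap hlat hup' hdn' p hp u v hu2 hv2 hu hv huv hlev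
  -- back to `X` through `z ↦ p₀ + B⁻¹ (A z)`
  refine ⟨s, hs, ((A.toLinearIsometryEquiv rfl).trans B.symm).toIsometryEquiv.trans
    (IsometryEquiv.addLeft p₀), Set.ext fun x => ⟨fun hx => ?_, ?_⟩⟩
  · have hx' : B (x - p₀) ∈ (fun x => B (x - p₀)) '' X := ⟨x, hx, rfl⟩
    rw [hXeq] at hx'
    obtain ⟨z, hz, hzx⟩ := hx'
    refine ⟨z, hz, ?_⟩
    simp only [IsometryEquiv.trans_apply, IsometryEquiv.addLeft_apply,
      LinearIsometryEquiv.coe_toIsometryEquiv, LinearIsometryEquiv.trans_apply,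
      LinearIsometry.coe_toLinearIsometryEquiv]
    rw [hzx, LinearIsometryEquiv.symm_apply_apply, add_sub_cancel]
  · rintro ⟨z, hz, rfl⟩
    have hz' : A z ∈ (fun x => B (x - p₀)) '' X := by
      rw [hXeq]
      exact ⟨z, hz, rfl⟩
    obtain ⟨x, hx, hxz⟩ := hz'
    have hx' : x = p₀ + B.symm (A z) := by
      rw [← hxz, LinearIsometryEquiv.symm_apply_apply, add_sub_cancel]
    simp only [IsometryEquiv.trans_apply, IsometryEquiv.addLeft_apply,
      LinearIsometryEquiv.coe_toIsometryEquiv, LinearIsometryEquiv.trans_apply,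
      LinearIsometry.coe_toLinearIsometryEquiv]
    rw [← hx']
    exact hx

end Summit.AtomisticToContinuum.Crystallization.Theorems.SquareWellLayerCake.StackingFaultSparsity.LocalFrames.CommonNormal

end
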